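import Summits.QuantumFields.BalabanUV.T4Continuum.Support.NE7TangentTransportCurved
import Summits.QuantumFields.BalabanUV.T4Continuum.Support.NE7TangentTransport
import HarnessLib

/-!
# NE7TangentTransportCurvedRightInv — THE CURVED (TT) LETTER WITH ROW NE3's EXACT RIGHT INVERSE: F66's hypothesis `hTT` SHAPE at a curved reference `W`,
# `|dAction U (Y′ − Y)| ≤ a·(curl1C∕(1−θℓ))·(M^d∕M²)·(Λ + 2·d·ω·C_F)·‖Y‖_{ℓ¹}` — F70's identity ∘ F41's tangent correction; letter (L4) of the curved (APE)
# programme, file 5 (docking)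

Cell `pub-balaban`, rung (B)+1 sub-cell t4, lineage `b2b-balaban-t4-ne7-p1` (CRUX PROVER NE7 #1 = OWNER of row NE7), generation 76; memo
`t4/b2b-balaban-t4-ne7-p1-g75/CURVED-APE-ROAD.md` §2 (L4).  File F71 (over F70 `NE7TangentTransportCurved.dirIter_add_gaugeDir_eq_Qbar_sub_Qbar_add_defect` (the identity
at a curved reference) ∕ `norm_Ad_inv_sub_Ad_inv_le`, F41 `NE7TangentTransport.tangent_correction` (row NE3's exact curved right inverse `rightInvW` with (R3) and F3:
`Y₁ − R_U(D_U Y₁)` is tangent at `U` at the cost `a·(curl1C∕(1−θℓ))·(M^d∕M²)·‖D_U Y₁‖_{ℓ¹(periodBox N)}`), F52's bookkeeping and `NE3PureGaugeFirstVariation.dAction_gaugeDir`).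
WHY.  F66 `NE7ApeCurvedRepDockingStrong` displays `hTT`: for the background `W` and a representative `U` (there `W·e^{Z}`), every skew periodic `Y` with `D_W Y = 0` has a
skew periodic `Y′` with `D_U Y′ = 0` and `|dAction U (Y′ − Y)| ≤ τ‖Y‖₁`.  THIS FILE proves that shape for ANY pair `(U, W)` of the multi-level class in route Π's W5∕W6 regime
with `τ = a·(curl1C∕(1−θℓ))·(M^d∕M²)·(Λ + 2·d·ω·C_F)` from three displayed letters: `Λ` — the `ℓ¹` base-Lipschitz letter of the straight towers (F68
`NE7QbarCurvedBaseTower.sum_norm_QbarIter_sub_QbarIter_le_Kmaj` with F69's radii: `Λ = K_maj·(L∕L^d)^k·Σ_i λ(r_i, x_i) = O((b + α̂)·M^{1−d})`), `ω` — the TOP MISMATCH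
`‖U_top − W_top‖_∞`, and `C_F` — the `ℓ¹` letter of the accumulated frame potential at `W`.  CURRENCY (memo successor note, the located point of F70): `K_G·τ` is of
the closing order `δ·small∕M²` iff `Λ + 2dωC_F = O(small·M^{1−d})`, i.e. iff the top mismatch is `ω = O(small·M^{1−d})` — automatic when `U` and `W` lie over the
SAME datum (`ω = 0`), NOT for a B8-type Landau representative `W e^{Z}` of a field over the same datum (its top is moved by the corner values of the gauge).
WHAT ([folklore]; 0 def, 0 sorry).
§1 `dirL1_dirIter_add_gaugeDir_le` — the `ℓ¹` size of F70's identity: `‖D_U(Y + gaugeDir_U λ)‖_{ℓ¹(periodBox N)} ≤ (Λ + 2·d·ω·C_F)·‖Y‖_{ℓ¹(periodBox T)}`.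
§2 **`tangent_transport_curved_rightInvW`** — F66's `hTT` SHAPE at the pair `(U, W)` with `τ = a·(curl1C∕(1−θℓ))·(M^d∕M²)·(Λ + 2·d·ω·C_F)`.
HONEST FRAMING (page 1): composition; `Λ`, `ω`, `C_F` are HYPOTHESES (Λ is F68+F69's by name once the radii are chosen; `C_F` at a curved `W` and the smallness of
`ω` are NOT proved here); (APE) on curved data NOT proved; NOT ONE-STEP, NOT NE7; spine 0∕9; finite T⁴ rung (B)+1 — NOT infinite volume, NOT mass gap, NOT `BetaPertH`,
NOT Clay.  Continuum YM on T⁴ ⇐ BetaPertH ∧ nine spine estimates (0/9 proved); BetaPertH ⇐ (D1) ∧ (D4) ∧ CAP+tail; G-an2-4 gates asym, D1 and NE2/3/4.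
-/

set_option autoImplicit false

open scoped BigOperators Matrix.Norms.L2Operator
open NormedSpace Finset

namespace Summit.QuantumFields.BalabanUV.T4Continuum.NE7TangentTransportCurvedRightInv

open Literature.MathematicalPhysics.QuantumFieldTheory.Balaban1983to89
open B7Prop1Explicit B7Prop2Explicit MatrixLog UnitaryModel
open T4AveragingDeficitWall (IsUnitaryCfg IsSkewDir SmallField Ad dirL1)
open T4AveragingDeficitWallBoundary (IsPeriodicCfg periodBox)
open AveragingDeficitPeriodicCounting (IsPeriodicDir)
open AveragingDeficitMultiLevelPrep (cavgIter LevelSmall tower cavgIter_unitary_small)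
open AveragingDeficitMultiLevelBridge (tower_eq)
open MinimalActionLevels (perWin)
open BlockAveragePushDirGauge (gaugeDir isPeriodicDir_gaugeDir)
open NE3TangentCovariantTower (dirIter QbarIter framePotW)
open NE3CurvedFrameKill (framePotW_skew_periodic pow_succ_mul_eq_tower)
open NE3LandauOrbit (gaugeDir_skew)
open NE3HessForm (dAction)
open NE3PureGaugeFirstVariation (dAction_gaugeDir)
open NE3QbarIterCovLiftPrep (cruxC)
open NE3RightInverseSolveLetters (thetaLoc)
open NE3HatInvCurlLetters (curl1C curl1C_nonneg)
open NE7TangentTransportGauge (dAction_sub' cornerLift_add_period)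
open NE7TangentTransport (tangent_correction)
open NE7TangentTransportCurved (dirIter_add_gaugeDir_eq_Qbar_sub_Qbar_add_defect norm_Ad_inv_sub_Ad_inv_le)

noncomputable section

variable {d : ℕ} {n : Type*} [Fintype n] [DecidableEq n]

/-! ## §1 The `ℓ¹` size of F70's identity -/

/-- **`‖D_U(Y + gaugeDir_U λ)‖_{ℓ¹(periodBox N)} ≤ (Λ + 2·d·ω·C_F)·‖Y‖_{ℓ¹(periodBox T)}`** for F70 §2's `λ` (the corner lift of `F_W Y − F_U Y`), at a `W`-tangent skew
`T`-periodic `Y` (`T = tower L N (k+1)`): F70's identity, the `Λ` letter, and the top mismatch against the frame letter. [folklore] -/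
theorem dirL1_dirIter_add_gaugeDir_le [Nonempty n] {L N : ℕ} [NeZero N] (hL : 1 ≤ L) (k : ℕ)
    {U W : Site d → Fin d → (Matrix n n ℂ)ˣ} {x : ℝ} (hUu : IsUnitaryCfg U) (hWu : IsUnitaryCfg W)
    (hUP : IsPeriodicCfg U ((tower L N (k + 1) : ℕ) : ℤ)) (hWP : IsPeriodicCfg W ((tower L N (k + 1) : ℕ) : ℤ))
    (hx : 0 ≤ x) (hs : LevelSmall d L k x) (hUx : SmallField U x) (hWx : SmallField W x)
    {ω : ℝ} (hω : 0 ≤ ω)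
    (hTop : ∀ (z : Site d) (κ : Fin d),
      ‖((cavgIter L (k + 1) U z κ : (Matrix n n ℂ)ˣ) : Matrix n n ℂ) - ((cavgIter L (k + 1) W z κ : (Matrix n n ℂ)ˣ) : Matrix n n ℂ)‖ ≤ ω)
    {CF : ℝ}
    (hF : ∀ Y : Site d → Fin d → Matrix n n ℂ, IsSkewDir Y → IsPeriodicDir Y ((tower L N (k + 1) : ℕ) : ℤ) → dirIter L (k + 1) W Y = 0 →
      ∑ z ∈ periodBox (d := d) N, ‖framePotW L (k + 1) W Y z‖ ≤ CF * dirL1 Y (periodBox (d := d) (tower L N (k + 1))))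
    {Λ : ℝ}
    (hΛ : ∀ Y : Site d → Fin d → Matrix n n ℂ, IsSkewDir Y → IsPeriodicDir Y ((tower L N (k + 1) : ℕ) : ℤ) → dirIter L (k + 1) W Y = 0 →
      ∑ z ∈ periodBox N, ∑ κ : Fin d, ‖QbarIter L (k + 1) U Y z κ - QbarIter L (k + 1) W Y z κ‖
        ≤ Λ * dirL1 Y (periodBox (d := d) (tower L N (k + 1))))
    {Y : Site d → Fin d → Matrix n n ℂ} (hY : IsSkewDir Y) (hYP : IsPeriodicDir Y ((tower L N (k + 1) : ℕ) : ℤ))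
    (hYT : dirIter L (k + 1) W Y = 0) :
    dirL1 (dirIter L (k + 1) U (fun y μ => Y y μ
        + gaugeDir U (fun xx : Site d => (fun w => framePotW L (k + 1) W Y w - framePotW L (k + 1) U Y w) (fun i => xx i / ((L : ℤ) ^ (k + 1)))) y μ))
        (periodBox (d := d) N)
      ≤ (Λ + 2 * d * ω * CF) * dirL1 Y (periodBox (d := d) (tower L N (k + 1))) := by
  set ψ := dirIter L (k + 1) U (fun y μ => Y y μ
        + gaugeDir U (fun xx : Site d => (fun w => framePotW L (k + 1) W Y w - framePotW L (k + 1) U Y w) (fun i => xx i / ((L : ℤ) ^ (k + 1)))) y μ)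
    with hψ
  have hTopU : IsUnitaryCfg (cavgIter L (k + 1) U) := (cavgIter_unitary_small hL k hUu hx hs hUx).1
  have hTopW : IsUnitaryCfg (cavgIter L (k + 1) W) := (cavgIter_unitary_small hL k hWu hx hs hWx).1
  have hψeq : ∀ (z : Site d) (κ : Fin d), ψ z κ = QbarIter L (k + 1) U Y z κ - QbarIter L (k + 1) W Y z κ
      + (Ad (cavgIter L (k + 1) U z κ)⁻¹ (framePotW L (k + 1) W Y z) - Ad (cavgIter L (k + 1) W z κ)⁻¹ (framePotW L (k + 1) W Y z)) :=
    fun z κ => dirIter_add_gaugeDir_eq_Qbar_sub_Qbar_add_defect hL k hUu hWu hUP hWP hx hs hUx hWx hY hYP hYT z κ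
  have hdef : ∀ (z : Site d) (κ : Fin d),
      ‖Ad (cavgIter L (k + 1) U z κ)⁻¹ (framePotW L (k + 1) W Y z) - Ad (cavgIter L (k + 1) W z κ)⁻¹ (framePotW L (k + 1) W Y z)‖
        ≤ 2 * ω * ‖framePotW L (k + 1) W Y z‖ := by
    intro z κ
    refine (norm_Ad_inv_sub_Ad_inv_le (hTopU z κ) (hTopW z κ) _).trans ?_
    have h0 : 0 ≤ ‖framePotW L (k + 1) W Y z‖ := norm_nonneg _
    nlinarith [hTop z κ, norm_nonneg (((cavgIter L (k + 1) U z κ : (Matrix n n ℂ)ˣ) : Matrix n n ℂ)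
      - ((cavgIter L (k + 1) W z κ : (Matrix n n ℂ)ˣ) : Matrix n n ℂ))]
  have hmain := hΛ Y hY hYP hYT
  have hfr := hF Y hY hYP hYT
  have h2 : 0 ≤ 2 * (d : ℝ) * ω := by positivity
  have hpt : ∀ z ∈ periodBox (d := d) N, ∑ κ : Fin d, ‖ψ z κ‖
      ≤ (∑ κ : Fin d, ‖QbarIter L (k + 1) U Y z κ - QbarIter L (k + 1) W Y z κ‖) + 2 * d * ω * ‖framePotW L (k + 1) W Y z‖ := by
    intro z _
    have hκ : ∀ κ : Fin d, ‖ψ z κ‖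
        ≤ ‖QbarIter L (k + 1) U Y z κ - QbarIter L (k + 1) W Y z κ‖ + 2 * ω * ‖framePotW L (k + 1) W Y z‖ := by
      intro κ
      rw [hψeq z κ]
      exact (norm_add_le _ _).trans (by linarith [hdef z κ])
    calc ∑ κ : Fin d, ‖ψ z κ‖
        ≤ ∑ κ : Fin d, (‖QbarIter L (k + 1) U Y z κ - QbarIter L (k + 1) W Y z κ‖ + 2 * ω * ‖framePotW L (k + 1) W Y z‖) :=
          Finset.sum_le_sum fun κ _ => hκ κ
      _ = (∑ κ : Fin d, ‖QbarIter L (k + 1) U Y z κ - QbarIter L (k + 1) W Y z κ‖) + 2 * d * ω * ‖framePotW L (k + 1) W Y z‖ := by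
          rw [Finset.sum_add_distrib, Finset.sum_const, Finset.card_univ, Fintype.card_fin, nsmul_eq_mul]
          ring
  have hsum : dirL1 ψ (periodBox (d := d) N)
      ≤ (∑ z ∈ periodBox N, ∑ κ : Fin d, ‖QbarIter L (k + 1) U Y z κ - QbarIter L (k + 1) W Y z κ‖)
        + 2 * d * ω * ∑ z ∈ periodBox (d := d) N, ‖framePotW L (k + 1) W Y z‖ := by
    have h := Finset.sum_le_sum hpt
    rw [Finset.sum_add_distrib, ← Finset.mul_sum] at h
    exact h
  calc dirL1 ψ (periodBox (d := d) N)
      ≤ (∑ z ∈ periodBox N, ∑ κ : Fin d, ‖QbarIter L (k + 1) U Y z κ - QbarIter L (k + 1) W Y z κ‖)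
          + 2 * d * ω * ∑ z ∈ periodBox (d := d) N, ‖framePotW L (k + 1) W Y z‖ := hsum
    _ ≤ Λ * dirL1 Y (periodBox (d := d) (tower L N (k + 1))) + 2 * d * ω * (CF * dirL1 Y (periodBox (d := d) (tower L N (k + 1)))) :=
        add_le_add hmain (mul_le_mul_of_nonneg_left hfr h2)
    _ = (Λ + 2 * d * ω * CF) * dirL1 Y (periodBox (d := d) (tower L N (k + 1))) := by ring

/-! ## §2 F66's `hTT` shape at a curved reference, with row NE3's right inverse -/

/-- **THE CURVED (TT) LETTER WITH THE EXACT RIGHT INVERSE.**  `L ≥ 2`, `N ≥ 1`, `k` levels, fine period `N·L^{k+1}`; `U`, `W` unitary periodic in the multi-level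
class at a common radius `x` with the W5∕W6 regime (`cruxC·M²x < 1`, `thetaLoc·M²x < 1`, `M²x ≤ 1`, `M = L^{k+1}`), `SmallField U a`; letters `ω` (top mismatch),
`C_F` (frame potential at `W` in `ℓ¹`), `Λ` (straight towers).  THEN every skew periodic `Y` with `D_W Y = 0` has a skew periodic `Y′` with `D_U Y′ = 0` and
`|dAction U (Y′ − Y) (perWin d (N·L^{k+1}))| ≤ a·(curl1C∕(1−θℓ))·(M^d∕M²)·(Λ + 2·d·ω·C_F)·‖Y‖_{ℓ¹(periodBox (N·L^{k+1}))}`: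
`Y′ = Y₁ − R_U(D_U Y₁)`, `Y₁ = Y + gaugeDir_U λ` (F70's `λ`), by F41's `tangent_correction` at `Y₁`, `dAction_gaugeDir`, and §1. [folklore] -/
theorem tangent_transport_curved_rightInvW [Nonempty n] {L : ℕ} (hL : 2 ≤ L) (k : ℕ) {N : ℕ} [NeZero N]
    {U W : Site d → Fin d → (Matrix n n ℂ)ˣ} {x a : ℝ} (hUu : IsUnitaryCfg U) (hWu : IsUnitaryCfg W)
    (hUP : IsPeriodicCfg U ((N * L ^ (k + 1) : ℕ) : ℤ)) (hWP : IsPeriodicCfg W ((N * L ^ (k + 1) : ℕ) : ℤ))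
    (hx : 0 ≤ x) (hs : LevelSmall d L k x) (hUx : SmallField U x) (hWx : SmallField W x)
    (hθ : cruxC d L * (((L : ℝ) ^ (k + 1)) ^ 2 * x) < 1) (hθl : thetaLoc d L * (((L : ℝ) ^ (k + 1)) ^ 2 * x) < 1)
    (hε : ((L : ℝ) ^ (k + 1)) ^ 2 * x ≤ 1) (ha : 0 ≤ a) (hUa : SmallField U a)
    {ω : ℝ} (hω : 0 ≤ ω)
    (hTop : ∀ (z : Site d) (κ : Fin d),
      ‖((cavgIter L (k + 1) U z κ : (Matrix n n ℂ)ˣ) : Matrix n n ℂ) - ((cavgIter L (k + 1) W z κ : (Matrix n n ℂ)ˣ) : Matrix n n ℂ)‖ ≤ ω)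
    {CF : ℝ}
    (hF : ∀ Y : Site d → Fin d → Matrix n n ℂ, IsSkewDir Y → IsPeriodicDir Y ((N * L ^ (k + 1) : ℕ) : ℤ) → dirIter L (k + 1) W Y = 0 →
      ∑ z ∈ periodBox (d := d) N, ‖framePotW L (k + 1) W Y z‖ ≤ CF * dirL1 Y (periodBox (d := d) (N * L ^ (k + 1))))
    {Λ : ℝ}
    (hΛ : ∀ Y : Site d → Fin d → Matrix n n ℂ, IsSkewDir Y → IsPeriodicDir Y ((N * L ^ (k + 1) : ℕ) : ℤ) → dirIter L (k + 1) W Y = 0 →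
      ∑ z ∈ periodBox N, ∑ κ : Fin d, ‖QbarIter L (k + 1) U Y z κ - QbarIter L (k + 1) W Y z κ‖
        ≤ Λ * dirL1 Y (periodBox (d := d) (N * L ^ (k + 1)))) :
    ∀ Y : Site d → Fin d → Matrix n n ℂ, IsSkewDir Y → IsPeriodicDir Y ((N * L ^ (k + 1) : ℕ) : ℤ) → dirIter L (k + 1) W Y = 0 →
      ∃ Y' : Site d → Fin d → Matrix n n ℂ, IsSkewDir Y' ∧ IsPeriodicDir Y' ((N * L ^ (k + 1) : ℕ) : ℤ) ∧ dirIter L (k + 1) U Y' = 0 ∧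
        |dAction U (fun y μ => Y' y μ - Y y μ) (perWin d (N * L ^ (k + 1)))|
          ≤ (a * ((curl1C d L / (1 - thetaLoc d L * (((L : ℝ) ^ (k + 1)) ^ 2 * x))) * (((L : ℝ) ^ (k + 1)) ^ d / ((L : ℝ) ^ (k + 1)) ^ 2))
              * (Λ + 2 * d * ω * CF)) * dirL1 Y (periodBox (d := d) (N * L ^ (k + 1))) := by
  intro Y hY hYP hYT
  have hL1 : 1 ≤ L := by omega
  have hm : ((L : ℤ) ^ (k + 1)) ≠ 0 := pow_ne_zero _ (by exact_mod_cast (show L ≠ 0 by omega))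
  -- the period in the tower spelling
  have htow : ((tower L N (k + 1) : ℕ) : ℤ) = ((N * L ^ (k + 1) : ℕ) : ℤ) := by rw [tower_eq]
  have htowN : tower L N (k + 1) = N * L ^ (k + 1) := tower_eq L N (k + 1)
  have hUP' : IsPeriodicCfg U ((tower L N (k + 1) : ℕ) : ℤ) := by rw [htow]; exact hUP
  have hWP' : IsPeriodicCfg W ((tower L N (k + 1) : ℕ) : ℤ) := by rw [htow]; exact hWP
  have hYP' : IsPeriodicDir Y ((tower L N (k + 1) : ℕ) : ℤ) := by rw [htow]; exact hYP
  have htowZ : ((tower L N (k + 1) : ℕ) : ℤ) = (L : ℤ) ^ (k + 1) * (N : ℤ) := (pow_succ_mul_eq_tower L N k).symm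
  -- the fine gauge generator of F70 and its letters
  set g : Site d → Matrix n n ℂ := fun w => framePotW L (k + 1) W Y w - framePotW L (k + 1) U Y w with hg
  set lam : Site d → Matrix n n ℂ := fun xx => g (fun i => xx i / ((L : ℤ) ^ (k + 1))) with hlam
  obtain ⟨hFUs, hFUP⟩ := framePotW_skew_periodic (M := N) hL1 k hUu hUP' hx hs hUx hY hYP'
  obtain ⟨hFWs, hFWP⟩ := framePotW_skew_periodic (M := N) hL1 k hWu hWP' hx hs hWx hY hYP'
  have hgs : ∀ w, g w ∈ skewAdjoint (Matrix n n ℂ) := fun w => (skewAdjoint (Matrix n n ℂ)).sub_mem (hFWs w) (hFUs w)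
  have hgP : ∀ (w : Site d) (i : Fin d), g (w + (N : ℤ) • e i) = g w := fun w i => by simp only [hg, hFWP w i, hFUP w i]
  have hlams : ∀ xx, lam xx ∈ skewAdjoint (Matrix n n ℂ) := fun xx => hgs _
  have hlamP : ∀ (y : Site d) (i : Fin d), lam (y + ((N * L ^ (k + 1) : ℕ) : ℤ) • e i) = lam y := fun y i => by
    rw [← htow, htowZ]; exact cornerLift_add_period g hm hgP y i
  set G : Site d → Fin d → Matrix n n ℂ := gaugeDir U lam with hG
  have hGs : IsSkewDir G := gaugeDir_skew hUu hlams
  have hGP : IsPeriodicDir G ((N * L ^ (k + 1) : ℕ) : ℤ) := isPeriodicDir_gaugeDir hUP hlamP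
  set Y₁ : Site d → Fin d → Matrix n n ℂ := fun y μ => Y y μ + G y μ with hY₁
  have hY₁s : IsSkewDir Y₁ := fun y μ => (skewAdjoint (Matrix n n ℂ)).add_mem (hY y μ) (hGs y μ)
  have hY₁P : IsPeriodicDir Y₁ ((N * L ^ (k + 1) : ℕ) : ℤ) := fun y i μ => by simp only [hY₁, hYP y i μ, hGP y i μ]
  -- F41's tangent correction at `Y₁`
  obtain ⟨Y', hY's, hY'P, hY'T, hb⟩ := tangent_correction hL k hUu hUP hx hs hUx hθ hθl hε ha hUa hY₁s hY₁P
  refine ⟨Y', hY's, hY'P, hY'T, ?_⟩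
  -- `dAction U (Y′ − Y) = dAction U (Y′ − Y₁)` since `dAction U G = 0`
  have hYeq : (fun y μ => Y₁ y μ - G y μ) = Y := by funext y μ; simp only [hY₁, add_sub_cancel_right]
  have hdA : dAction U (fun y μ => Y' y μ - Y y μ) (perWin d (N * L ^ (k + 1)))
      = dAction U (fun y μ => Y' y μ - Y₁ y μ) (perWin d (N * L ^ (k + 1))) := by
    rw [dAction_sub', dAction_sub']
    conv_lhs => rw [← hYeq, dAction_sub', hG, dAction_gaugeDir, sub_zero]
  rw [hdA]
  refine hb.trans ?_
  -- §1 in the `N·L^{k+1}` spelling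
  have hF' : ∀ Y : Site d → Fin d → Matrix n n ℂ, IsSkewDir Y → IsPeriodicDir Y ((tower L N (k + 1) : ℕ) : ℤ) → dirIter L (k + 1) W Y = 0 →
      ∑ z ∈ periodBox (d := d) N, ‖framePotW L (k + 1) W Y z‖ ≤ CF * dirL1 Y (periodBox (d := d) (tower L N (k + 1))) := by
    intro Y₂ hY₂ hY₂P hY₂T; rw [htowN]; rw [htow] at hY₂P; exact hF Y₂ hY₂ hY₂P hY₂T
  have hΛ' : ∀ Y : Site d → Fin d → Matrix n n ℂ, IsSkewDir Y → IsPeriodicDir Y ((tower L N (k + 1) : ℕ) : ℤ) → dirIter L (k + 1) W Y = 0 →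
      ∑ z ∈ periodBox N, ∑ κ : Fin d, ‖QbarIter L (k + 1) U Y z κ - QbarIter L (k + 1) W Y z κ‖
        ≤ Λ * dirL1 Y (periodBox (d := d) (tower L N (k + 1))) := by
    intro Y₂ hY₂ hY₂P hY₂T; rw [htowN]; rw [htow] at hY₂P; exact hΛ Y₂ hY₂ hY₂P hY₂T
  have h1 := dirL1_dirIter_add_gaugeDir_le hL1 k hUu hWu hUP' hWP' hx hs hUx hWx hω hTop hF' hΛ' hY hYP' hYT
  rw [htowN] at h1
  have hψY₁ : dirIter L (k + 1) U Y₁ = dirIter L (k + 1) U (fun y μ => Y y μ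
        + gaugeDir U (fun xx : Site d => (fun w => framePotW L (k + 1) W Y w - framePotW L (k + 1) U Y w) (fun i => xx i / ((L : ℤ) ^ (k + 1)))) y μ) := by
    rfl
  have hpos : 0 < 1 - thetaLoc d L * (((L : ℝ) ^ (k + 1)) ^ 2 * x) := by linarith
  have hc : 0 ≤ a * ((curl1C d L / (1 - thetaLoc d L * (((L : ℝ) ^ (k + 1)) ^ 2 * x))) * (((L : ℝ) ^ (k + 1)) ^ d / ((L : ℝ) ^ (k + 1)) ^ 2)) := by
    have := curl1C_nonneg d L; positivity
  rw [hψY₁]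
  calc a * ((curl1C d L / (1 - thetaLoc d L * (((L : ℝ) ^ (k + 1)) ^ 2 * x))) * (((L : ℝ) ^ (k + 1)) ^ d / ((L : ℝ) ^ (k + 1)) ^ 2)
          * dirL1 (dirIter L (k + 1) U (fun y μ => Y y μ
              + gaugeDir U (fun xx : Site d => (fun w => framePotW L (k + 1) W Y w - framePotW L (k + 1) U Y w)
                  (fun i => xx i / ((L : ℤ) ^ (k + 1)))) y μ)) (periodBox (d := d) N))
      = (a * ((curl1C d L / (1 - thetaLoc d L * (((L : ℝ) ^ (k + 1)) ^ 2 * x))) * (((L : ℝ) ^ (k + 1)) ^ d / ((L : ℝ) ^ (k + 1)) ^ 2)))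
          * dirL1 (dirIter L (k + 1) U (fun y μ => Y y μ
              + gaugeDir U (fun xx : Site d => (fun w => framePotW L (k + 1) W Y w - framePotW L (k + 1) U Y w)
                  (fun i => xx i / ((L : ℤ) ^ (k + 1)))) y μ)) (periodBox (d := d) N) := by ring
    _ ≤ (a * ((curl1C d L / (1 - thetaLoc d L * (((L : ℝ) ^ (k + 1)) ^ 2 * x))) * (((L : ℝ) ^ (k + 1)) ^ d / ((L : ℝ) ^ (k + 1)) ^ 2)))
          * ((Λ + 2 * d * ω * CF) * dirL1 Y (periodBox (d := d) (N * L ^ (k + 1)))) := mul_le_mul_of_nonneg_left h1 hc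
    _ = _ := by ring

end

end Summit.QuantumFields.BalabanUV.T4Continuum.NE7TangentTransportCurvedRightInv
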